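import Literature.NumberTheory.GaloisRepresentations.HeckeCharacter
import HarnessLib

/-!
# Archimedean types of unitary Hecke characters: Weil's unit criterion

Topic `NumberTheory/GaloisRepresentations` (Hecke characters live here in this tree, next to
`HeckeCharacter.lean`); namespace `Literature.NumberTheory.GaloisRepresentations`.

A unitary Hecke character `ψ` of a number field `K` restricts on the infinite ideles
`K_∞ˣ = ∏_{w ∣ ∞} K_wˣ` to a product of unitary characters of `ℝˣ` / `ℂˣ`, which (fixing the
embeddings `ι_w : K_w → ℂ` of Mathlib, `InfinitePlace.Completion.extensionEmbedding w`) are of the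
form `x ↦ (ι_w x / |ι_w x|)^{m_w} · |ι_w x|^{i t_w}` with `m_w ∈ ℤ`, `t_w ∈ ℝ` — the **archimedean
parameters** `{m_w, t_w}_{w ∣ ∞}` of `ψ` (Patrikis 2019, §2.1, display before Lemma 2.1.1). This file
records, as a named fact, WEIL'S UNIT CRITERION for which families of parameters occur:

* `HeckeCharacter.HasUnitaryArchType ψ m t` (predicate): `ψ((x,1)) = ∏_w (ι_w x_w/|ι_w x_w|)^{m_w}
  |ι_w x_w|^{i t_w}` for every infinite idele `x`.
* `Patrikis2019_heckeCharacter_archType_iff_units` (named fact, Patrikis 2019 Lemma 2.1.1 = Weil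
  1956): such a unitary `ψ` exists iff for some `M ≥ 1` every global unit `α` satisfies
  `(∏_w (ι_w α/|ι_w α|)^{m_w} |ι_w α|^{i t_w})^M = 1`, equivalently the product is trivial on a
  finite-index subgroup of `𝓞_Kˣ`.

The tree already PROVES the necessity direction for algebraic types (`A₀`):
`HeckeCharacter.HasInfinityType.prod_embedding_unit_pow_eq_one`
(`AlgebraicHeckeCharacterPurity`). The existence direction (Chevalley's congruence-subgroup
theorem for units + extension of unitary characters from the open finite-index subgroup
`K_∞ˣ·𝓞̂ˣ·Kˣ/Kˣ` of the idele class group) is not in the tree; it is the input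
"HeckeCharacterOfUnitTrivialType" of route `Langlands/IrreducibilityBySelfDuality` and grounds
`Summit.Langlands.Langlands.Theses.IrreducibilityBySelfDuality.RegularTwistCM`
(stmt-Langlands-14069: the re-twisting character `χ_w = z^{1/2−s₁} z̄^{1/2−t₁}` is produced from its
archimedean type by exactly this criterion, the type being trivial on the squares of the totally
positive units of `K⁺`, of finite index in `𝓞_Kˣ` when `K` is CM).

## Normalisation

Patrikis writes the local character with the normalised absolute value `|·|_ℂ = |·|²` at complex
places (`|ι_v(x_v)|_ℂ^{i t_v}`) but the unit relation of Lemma 2.1.1 with `|ι_v(α)|^{i t_v}`; here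
BOTH sides use the ordinary modulus `‖ι_w(·)‖` of `ℂ`, so `t_w` is Patrikis's `t_v` at real places
and `2 t_v` at complex places — a reparametrisation of the real parameters that does not change the
statement. No norm twist `|·|^r` is included (the lemma is stated for unitary `ψ`, "unitary, say").

## Mathlib search

Mathlib (this pin) has `NumberField.InfinitePlace.embedding`, `InfinitePlace.Completion.
extensionEmbedding`, `NumberField.InfiniteAdeleRing` (= `Π w, w.Completion`), Dirichlet's unit
theorem, but no Hecke characters (tree: `HeckeCharacter.lean`) and no statement of Weil's
criterion or of Chevalley's theorem on units (grep `Chevalley`, `congruence subgroup` in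
`NumberTheory/NumberField`: nothing).

## References

* S. Patrikis, *Variations on a theorem of Tate*, Mem. AMS 258 (2019), no. 1238 = arXiv:1207.6724,
  §2.1, Lemma 2.1.1 (p. 18 of the arXiv version: "There is a (unitary, say) Hecke character ψ of F
  with archimedean parameters {m_v, t_v}_{v∣∞}, as above, if and only if for some positive integer
  M, all global units α ∈ 𝓞_Fˣ satisfy (∏_{v∣∞} (ι_v(α)/|ι_v(α)|)^{m_v} |ι_v(α)|^{i t_v})^M = 1.
  Equivalently, the inside product is trivial for all α in some finite-index subgroup of 𝓞_Fˣ.").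
  [Patrikis2019]
* A. Weil, *On a certain type of characters of the idèle-class group of an algebraic
  number-field*, Proc. Int. Symp. Tokyo–Nikko (1956), 1–7. [Weil1956]
* C. Chevalley, *Deux théorèmes d'arithmétique*, J. Math. Soc. Japan 3 (1951), 36–44 (every
  finite-index subgroup of `𝓞_Kˣ` contains a congruence subgroup). [Chevalley1951]
-/

noncomputable section

open NumberField

namespace Literature.NumberTheory.GaloisRepresentations

universe u

variable {K : Type u} [Field K] [NumberField K]

/-- The value at `z ∈ ℂˣ` of the unitary quasi-character of `ℂˣ` (or of `ℝˣ ⊂ ℂˣ`) with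
parameters `(m, t)`: `(z/|z|)^m · |z|^{i t}` (complex power of the positive real `|z|`).
[cite: Patrikis2019, §2.1, display before Lemma 2.1.1] -/
def archUnitaryValue (m : ℤ) (t : ℝ) (z : ℂ) : ℂ :=
  (z / (‖z‖ : ℂ)) ^ m * (‖z‖ : ℂ) ^ ((t : ℂ) * Complex.I)

/-- `ψ` **has unitary archimedean type `(m, t)`**: on the infinite ideles,
`ψ((x, 1)) = ∏_{w ∣ ∞} (ι_w x_w/|ι_w x_w|)^{m_w} |ι_w x_w|^{i t_w}` with Mathlib's embeddings
`ι_w = InfinitePlace.Completion.extensionEmbedding w` (for a real place only `m_w mod 2` matters).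
A predicate on `ψ`, not a fact. [cite: Patrikis2019, §2.1, display before Lemma 2.1.1] -/
def HeckeCharacter.HasUnitaryArchType (ψ : HeckeCharacter K) (m : InfinitePlace K → ℤ)
    (t : InfinitePlace K → ℝ) : Prop :=
  ∀ x : (InfiniteAdeleRing K)ˣ,
    (ψ (infiniteIdeles K x) : ℂ) =
      ∏ w : InfinitePlace K,
        archUnitaryValue (m w) (t w)
          (InfinitePlace.Completion.extensionEmbedding w ((x : InfiniteAdeleRing K) w))

/-- **Weil's unit criterion for archimedean types (Patrikis 2019, Lemma 2.1.1).** For a number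
field `K` and parameters `m_w ∈ ℤ`, `t_w ∈ ℝ` (`w ∣ ∞`): there is a unitary Hecke character `ψ`
of `K` with archimedean parameters `{m_w, t_w}` — `ψ((x,1)) = ∏_w (ι_w x_w/|ι_w x_w|)^{m_w}
|ι_w x_w|^{i t_w}` on `K_∞ˣ` — if and only if for some positive integer `M` all global units
`α ∈ 𝓞_Kˣ` satisfy `(∏_w (ι_w α/|ι_w α|)^{m_w} |ι_w α|^{i t_w})^M = 1` (equivalently: the product is
trivial on a finite-index subgroup of `𝓞_Kˣ`). Normalisation of `t_w`: module docstring. Grounds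
`Summit.Langlands.Langlands.Theses.IrreducibilityBySelfDuality.RegularTwistCM` (existence of the
re-twisting Hecke character from its archimedean type).
[cite: Patrikis2019, Lemma 2.1.1] [cite: Weil1956] -/
def Patrikis2019_heckeCharacter_archType_iff_units : Prop :=
  ∀ (K : Type) [Field K] [NumberField K] (m : InfinitePlace K → ℤ) (t : InfinitePlace K → ℝ),
    (∃ ψ : HeckeCharacter K, ψ.IsUnitary ∧ ψ.HasUnitaryArchType m t) ↔
      ∃ M : ℕ, 0 < M ∧ ∀ α : (𝓞 K)ˣ,
        (∏ w : InfinitePlace K, archUnitaryValue (m w) (t w) (w.embedding ((α : 𝓞 K) : K))) ^ M = 1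

/-- Unfolding lemma for `HasUnitaryArchType`. [folklore] -/
theorem HeckeCharacter.hasUnitaryArchType_iff (ψ : HeckeCharacter K) (m : InfinitePlace K → ℤ)
    (t : InfinitePlace K → ℝ) :
    ψ.HasUnitaryArchType m t ↔ ∀ x : (InfiniteAdeleRing K)ˣ,
      (ψ (infiniteIdeles K x) : ℂ) = ∏ w : InfinitePlace K, archUnitaryValue (m w) (t w)
        (InfinitePlace.Completion.extensionEmbedding w ((x : InfiniteAdeleRing K) w)) :=
  Iff.rfl

/-- `archUnitaryValue m t z` has modulus `1` for `z ≠ 0` (it is a value of a unitary character).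
[folklore] -/
theorem norm_archUnitaryValue {z : ℂ} (hz : z ≠ 0) (m : ℤ) (t : ℝ) :
    ‖archUnitaryValue m t z‖ = 1 := by
  have hz' : (‖z‖ : ℂ) ≠ 0 := by exact_mod_cast (norm_ne_zero_iff.mpr hz)
  have hpos : 0 < ‖z‖ := norm_pos_iff.mpr hz
  unfold archUnitaryValue
  rw [norm_mul, norm_zpow, norm_div, Complex.norm_real, Real.norm_eq_abs, abs_norm,
    div_self (norm_ne_zero_iff.mpr hz), one_zpow, one_mul]
  rw [Complex.norm_cpow_eq_rpow_re_of_pos (by exact_mod_cast hpos)]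
  simp

end Literature.NumberTheory.GaloisRepresentations
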